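import Summits.QuantumFields.BalabanUV.Beta.GAN24.AveragedPropagatorDefectFields
import Summits.QuantumFields.BalabanUV.Beta.GAN24.BlockFieldDecay
import Summits.QuantumFields.BalabanUV.Beta.GAN24.QvOpSupLocality
import Summits.QuantumFields.BalabanUV.T4Continuum.Support.ScalarBlockTrialFunction

/-!
# G-an2-4 ∕ (CONV-C), road P2, route R2-S1, VECTOR LAYER, PART 8 — LOCALITY TRANSPORTS FOR THE KERNEL CURRENCY: how exponential decay from a
# unit site (`BlockFieldDecay.FieldDecay`) passes through `Q_k*`, `Q_k`, the averaging defects `E₁`, `E₂`, the componentwise staircase, a fine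
# unit shift, the component embedding, and the defect fields `PhiL`∕`PsiF`∕`phiF`∕`phiLdiv` of Part 4 — every constant explicit (`e^{δ}` per unit step)

Unit `b2b-balaban-gan24-p2` (gen 30), BINDER row G-an2-4 ∕ (CONV-C), road P2; crux team (2).  Part 9 (`AveragedPropagatorOneStepDecay`) turns Part 5's
sup law of `c_n = Q_n𝒢_nQ_n*` into the row's KERNEL currency (decay `e^{−δ|y−y′|}` of the one-step difference kernel) by pushing
`FieldDecay` through the identity `c′ − c = Q′𝒢′E₂ + E₁𝒢Q* − Q′𝒢′·𝔇·𝒢Q*` of Part 3.  The `𝒢`-factors are handled by `BlockFieldDecay.fieldDecay_mulVec`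
with the swarm's `RowDecay` letters (`VectorRowDecayLetters`, leaf-06 gen 36); THIS FILE supplies the transports through every OTHER factor:
 * §1 geometry on `T_η` over `T₁` (dimension `d+1`): `blockOf_add_unitVec`, `blockOf_sub_unitVec` (a fine unit step moves the block by at most one
   unit step; via `ScalarBlockTrialFunction.bpt_add_unitVec_of_lt ∕ _of_eq`), **`exp_tsn_le_of_adj`** (`e^{−δ|b′−y′|} ≤ e^{δ}·e^{−δ|b−y′|}` for
   adjacent blocks `b′ ∈ {b, b ± e_μ}`; leaf-01's `QvOpSupLocality` torus-metric lemmas);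
 * §2 transports of `FieldDecay` (constants in brackets): `fieldDecay_shift_add ∕ _sub` (`[e^{δ}]`), `fieldDecay_parV` (fields `i ↦ F(par i.1, i.2)`, `[1]`),
   `fieldDecay_emb` (`[1]`), **`fieldDecay_QvAdj`** (`Q*`, `[e^{δ}]`), **`fieldDecay_QvOp`** (`Q`, `[1 + e^{δ}]`, leaf-01's `norm_QvOp_mulVec_le`),
   **`fieldDecay_adjDefect`** (`E₂`, `[ρ(1 + e^{δ})]`), **`fieldDecay_fwdDefect`** (`E₁`, `[ρ(1 + e^{δ})∕2]`·, `ρ = (R−1)∕(RN)`);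
 (the defect fields `PhiL`∕`PsiF`∕`phiF`∕`phiLdiv` of Part 4 are transported in the companion `AveragedPropagatorDefectDecay`.)
HONEST SCOPE.  Finite-lattice bookkeeping at `U = 1`, every `d`, `N, R ≥ 1`, every torus in dimension `d + 1`; [folklore], kernel-checked, no `sorry`,
no `def … : Prop`.  NOT (CONV-C), NEVER «G-an2-4 closed», NOT NE2, NOT D1, NOT BetaPertH, NOT continuum, NOT Clay; not in print — our bookkeeping.
HONEST DEPENDENCY: continuum YM on T⁴ ⇐ BetaPertH ∧ nine spine estimates (0/9 proved); BetaPertH ⇐ (D1) ∧ (D4) ∧ CAP+tail; G-an2-4 gates asym,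
D1 and NE2/3/4.
-/

noncomputable section

open scoped BigOperators ComplexConjugate Matrix

namespace Summit.QuantumFields.BalabanUV.Beta.GAN24.AveragedPropagatorLocality

open Literature.MathematicalPhysics.QuantumFieldTheory.Balaban1983to89
open B5Prop11Plancherel (Tor fine fdiff shiftM)
open B5Block118 (tstep bpt QvOp)
open B5Blocks16 (blockOf blockOf_bpt bpt_bijective)
open B5DeltaA169 (QvAdj)
open B6LowerBound2153Torus (rep toT toT_rep toT_add toT_unitVec)
open B4TorusKernel.MultiPeriod (torusSupNorm)
open B5G183FreeRowSum (fdiff_mulVec shiftM_mulVec)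
open Summit.QuantumFields.BalabanUV.T4Continuum.BalabanAveragedTowerModes (par)
open Summit.QuantumFields.BalabanUV.T4Continuum.ScalarPlantingDefect (blockOf_par)
open Summit.QuantumFields.BalabanUV.T4Continuum.ScalarBlockTrialFunction (bpt_add_unitVec_of_lt bpt_add_unitVec_of_eq)
open Summit.QuantumFields.BalabanUV.T4Continuum.LineAveragingPairing (cL cL_eq)
open Summit.QuantumFields.BalabanUV.Beta.GAN24.QvOpSupLocality (torusSupNorm_congr_toT torusSupNorm_add_le' torusSupNorm_smul_unitVec_le
  toT_sub' norm_QvOp_mulVec_le)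
open Summit.QuantumFields.BalabanUV.Beta.GAN24.StaircaseLaplacianDefect (stair stair_mulVec piL piF norm_piL_le norm_piF_le)
open Summit.QuantumFields.BalabanUV.Beta.GAN24.StaircaseLineSumDefect (QvAdj_mulVec_apply blockOf_sub_tstep_n)
open Summit.QuantumFields.BalabanUV.Beta.GAN24.StaircaseAveragingDefect (stairV fwdDefect adjDefect stairV_mulVec fwdDefect_mulVec_apply
  adjDefect_mulVec_apply ratio_nonneg)
open Summit.QuantumFields.BalabanUV.Beta.GAN24.BlockFieldDecay (RowDecay FieldDecay)
open Summit.QuantumFields.BalabanUV.Beta.GAN24.AveragedPropagatorDefectFields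

variable {d : ℕ}

/-! ## §1 Geometry: a fine unit step moves the block by at most one unit step -/

section Geometry

variable (n : ℕ) [NeZero n] (M : Fin (d + 1) → ℕ) [hM : ∀ μ, NeZero (M μ)]

/-- a fine unit step stays in the block or enters the next one. [folklore] -/
theorem blockOf_add_unitVec (x : Tor (fine n M)) (ν : Fin (d + 1)) :
    blockOf n M (x + B5Prop11Plancherel.unitVec (fine n M) ν) = blockOf n M x ∨
      blockOf n M (x + B5Prop11Plancherel.unitVec (fine n M) ν) = blockOf n M x + B5Prop11Plancherel.unitVec M ν := by
  obtain ⟨⟨y, j⟩, rfl⟩ := (bpt_bijective n M).2 x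
  rw [blockOf_bpt]
  by_cases h : (j ν : ℕ) + 1 < n
  · left; rw [bpt_add_unitVec_of_lt n M y j ν h, blockOf_bpt]
  · right
    have he : (j ν : ℕ) + 1 = n := by have := (j ν).isLt; omega
    rw [bpt_add_unitVec_of_eq n M y j ν he, blockOf_bpt]

/-- a fine unit step backwards stays in the block or enters the previous one. [folklore] -/
theorem blockOf_sub_unitVec (x : Tor (fine n M)) (ν : Fin (d + 1)) :
    blockOf n M (x - B5Prop11Plancherel.unitVec (fine n M) ν) = blockOf n M x ∨
      blockOf n M (x - B5Prop11Plancherel.unitVec (fine n M) ν) = blockOf n M x - B5Prop11Plancherel.unitVec M ν := by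
  rcases blockOf_add_unitVec n M (x - B5Prop11Plancherel.unitVec (fine n M) ν) ν with h | h
  · left; rw [sub_add_cancel] at h; exact h.symm
  · right; rw [sub_add_cancel] at h; rw [h, add_sub_cancel_right]

omit hM in
/-- **adjacent blocks cost a factor `e^{δ}`**: if `b′ ∈ {b, b + e_μ, b − e_μ}` then `e^{−δ|b′ − y′|_{T,∞}} ≤ e^{δ}·e^{−δ|b − y′|_{T,∞}}` (`δ ≥ 0`). [folklore] -/
theorem exp_tsn_le_of_adj [hM : ∀ μ, NeZero (M μ)] {δ : ℝ} (hδ : 0 ≤ δ) (b b' y' : Tor M) (μ : Fin (d + 1))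
    (h : b' = b ∨ b' = b + B5Prop11Plancherel.unitVec M μ ∨ b' = b - B5Prop11Plancherel.unitVec M μ) :
    Real.exp (-(δ * torusSupNorm M (rep M b' - rep M y'))) ≤ Real.exp δ * Real.exp (-(δ * torusSupNorm M (rep M b - rep M y'))) := by
  -- it suffices: |b − y′| ≤ |b′ − y′| + 1
  suffices ht : torusSupNorm M (rep M b - rep M y') ≤ torusSupNorm M (rep M b' - rep M y') + 1 by
    rw [← Real.exp_add]
    exact Real.exp_le_exp.mpr (by nlinarith)
  have hp := torusSupNorm_smul_unitVec_le M μ 1 (Or.inl rfl)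
  have hm := torusSupNorm_smul_unitVec_le M μ (-1) (Or.inr rfl)
  rw [one_smul] at hp
  rw [neg_one_smul] at hm
  rcases h with h | h | h
  · rw [h]; linarith
  · -- rep b − rep y′ ≡ (rep b′ − rep y′) − e
    have hneg : toT M (-B6BondElimination.unitVec μ) = -B5Prop11Plancherel.unitVec M μ := by
      rw [← toT_unitVec (M := M) μ]
      funext i
      simp [toT]
    have e1 : torusSupNorm M (rep M b - rep M y') = torusSupNorm M ((rep M b' - rep M y') + -B6BondElimination.unitVec μ) := by
      refine torusSupNorm_congr_toT M ?_
      rw [toT_add, ← toT_sub', ← toT_sub', toT_rep, toT_rep, toT_rep, h, hneg]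
      abel
    rw [e1]; exact (torusSupNorm_add_le' M _ _).trans (by linarith)
  · have e1 : torusSupNorm M (rep M b - rep M y') = torusSupNorm M ((rep M b' - rep M y') + B6BondElimination.unitVec μ) := by
      refine torusSupNorm_congr_toT M ?_
      rw [toT_add, ← toT_sub', ← toT_sub', toT_rep, toT_rep, toT_rep, h, toT_unitVec]
      abel
    rw [e1]; exact (torusSupNorm_add_le' M _ _).trans (by linarith)

end Geometry


/-! ## §2 Transports of `FieldDecay` -/

section Transport

variable (n : ℕ) [NeZero n] (M : Fin (d + 1) → ℕ) [hM : ∀ μ, NeZero (M μ)]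

/-- a fine unit shift forward costs `e^{δ}`. [folklore] -/
theorem fieldDecay_shift_add {F : Tor (fine n M) × Fin (d + 1) → ℂ} {b δ : ℝ} {y' : Tor M} (hb : 0 ≤ b) (hδ : 0 ≤ δ)
    (h : FieldDecay M (fun i : Tor (fine n M) × Fin (d + 1) => blockOf n M i.1) F b δ y') (ν : Fin (d + 1)) :
    FieldDecay M (fun i : Tor (fine n M) × Fin (d + 1) => blockOf n M i.1)
      (fun i => F (i.1 + B5Prop11Plancherel.unitVec (fine n M) ν, i.2)) (Real.exp δ * b) δ y' := by
  intro i
  have h1 := h (i.1 + B5Prop11Plancherel.unitVec (fine n M) ν, i.2)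
  have hadj := exp_tsn_le_of_adj M hδ (blockOf n M i.1) (blockOf n M (i.1 + B5Prop11Plancherel.unitVec (fine n M) ν)) y' ν
    (by rcases blockOf_add_unitVec n M i.1 ν with e | e
        · exact Or.inl e
        · exact Or.inr (Or.inl e))
  dsimp only at h1 ⊢
  calc _ ≤ _ := h1
    _ ≤ b * (Real.exp δ * Real.exp (-(δ * torusSupNorm M (rep M (blockOf n M i.1) - rep M y')))) :=
        mul_le_mul_of_nonneg_left hadj hb
    _ = _ := by ring

/-- a fine unit shift backward costs `e^{δ}`. [folklore] -/
theorem fieldDecay_shift_sub {F : Tor (fine n M) × Fin (d + 1) → ℂ} {b δ : ℝ} {y' : Tor M} (hb : 0 ≤ b) (hδ : 0 ≤ δ)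
    (h : FieldDecay M (fun i : Tor (fine n M) × Fin (d + 1) => blockOf n M i.1) F b δ y') (ν : Fin (d + 1)) :
    FieldDecay M (fun i : Tor (fine n M) × Fin (d + 1) => blockOf n M i.1)
      (fun i => F (i.1 - B5Prop11Plancherel.unitVec (fine n M) ν, i.2)) (Real.exp δ * b) δ y' := by
  intro i
  have h1 := h (i.1 - B5Prop11Plancherel.unitVec (fine n M) ν, i.2)
  have hadj := exp_tsn_le_of_adj M hδ (blockOf n M i.1) (blockOf n M (i.1 - B5Prop11Plancherel.unitVec (fine n M) ν)) y' ν
    (by rcases blockOf_sub_unitVec n M i.1 ν with e | e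
        · exact Or.inl e
        · exact Or.inr (Or.inr e))
  dsimp only at h1 ⊢
  calc _ ≤ _ := h1
    _ ≤ b * (Real.exp δ * Real.exp (-(δ * torusSupNorm M (rep M (blockOf n M i.1) - rep M y')))) :=
        mul_le_mul_of_nonneg_left hadj hb
    _ = _ := by ring

/-- the component embedding transports decay (same constant). [folklore] -/
theorem fieldDecay_emb {φ : Tor (fine n M) → ℂ} {b δ : ℝ} {y' : Tor M} (hb : 0 ≤ b)
    (h : FieldDecay M (blockOf n M) φ b δ y') (μ : Fin (d + 1)) :
    FieldDecay M (fun i : Tor (fine n M) × Fin (d + 1) => blockOf n M i.1) (AveragedPropagatorDefectFields.emb μ φ) b δ y' := by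
  intro i
  unfold AveragedPropagatorDefectFields.emb
  split_ifs
  · exact h i.1
  · rw [norm_zero]; positivity

/-- **`Q*` transports decay from the unit lattice to the fine lattice, constant `e^{δ}`**: `(Q*g)_μ(x)` re-reads `g` on the two unit bonds
`⟨z̄, z̄ + e_μ⟩`, `z̄ ∈ {ȳ, ȳ − e_μ}` through `x ∈ B(ȳ)` (leaf-01's `QvOpSupLocality.norm_QvOp_conjTranspose_mulVec_le`). [folklore] -/
theorem fieldDecay_QvAdj {g : Tor M × Fin (d + 1) → ℂ} {b δ : ℝ} {y' : Tor M} (hb : 0 ≤ b) (hδ : 0 ≤ δ)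
    (h : FieldDecay M Prod.fst g b δ y') :
    FieldDecay M (fun i : Tor (fine n M) × Fin (d + 1) => blockOf n M i.1) (QvAdj n M *ᵥ g) (Real.exp δ * b) δ y' := by
  intro i
  obtain ⟨x, μ⟩ := i
  obtain ⟨⟨y, r⟩, rfl⟩ := (bpt_bijective n M).2 x
  dsimp only
  rw [blockOf_bpt]
  set S : ℝ := Real.exp δ * b * Real.exp (-(δ * torusSupNorm M (rep M y - rep M y'))) with hS
  have hS0 : 0 ≤ S := by positivity
  have hn : (0 : ℝ) < (n : ℝ) ^ (d + 1) := by have : (0:ℝ) < n := by exact_mod_cast Nat.pos_of_ne_zero (NeZero.ne n)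
                                              positivity
  -- the two unit bonds through `x`
  have hw : ∀ z : Fin (d + 1) → ℤ, (toT M z = toT M (rep M y) ∨ toT M (z + B6BondElimination.unitVec μ) = toT M (rep M y)) →
      ‖g (toT M z, μ)‖ ≤ S := by
    intro z hz
    have hg := h (toT M z, μ)
    dsimp only at hg
    have hadj : Real.exp (-(δ * torusSupNorm M (rep M (toT M z) - rep M y')))
        ≤ Real.exp δ * Real.exp (-(δ * torusSupNorm M (rep M y - rep M y'))) := by
      refine exp_tsn_le_of_adj M hδ y (toT M z) y' μ ?_
      rw [toT_rep] at hz
      rcases hz with hz | hz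
      · exact Or.inl hz
      · right; right
        rw [toT_add, toT_unitVec] at hz
        rw [← hz, add_sub_cancel_right]
    calc _ ≤ _ := hg
      _ ≤ b * (Real.exp δ * Real.exp (-(δ * torusSupNorm M (rep M y - rep M y')))) := mul_le_mul_of_nonneg_left hadj hb
      _ = S := by rw [hS]; ring
  have key := QvOpSupLocality.norm_QvOp_conjTranspose_mulVec_le n M g (rep M y) r μ hS0 hw
  rw [toT_rep] at key
  rw [B5DeltaA169.QvAdj_mulVec, Pi.smul_apply, smul_eq_mul, norm_mul, norm_pow, Complex.norm_natCast]
  calc (n : ℝ) ^ (d + 1) * ‖((QvOp n M)ᴴ *ᵥ g) (bpt n M y r, μ)‖ ≤ (n : ℝ) ^ (d + 1) * (S / (n : ℝ) ^ (d + 1)) :=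
        mul_le_mul_of_nonneg_left key hn.le
    _ = S := by field_simp

/-- **`Q` transports decay from the fine lattice to the unit lattice, constant `1 + e^{δ}`**: `(QF)(⟨z̄, z̄+e_μ⟩)` reads `F` on `B(z̄) ∪ B(z̄ + e_μ)`
(leaf-01's `QvOpSupLocality.norm_QvOp_mulVec_le`). [folklore] -/
theorem fieldDecay_QvOp {F : Tor (fine n M) × Fin (d + 1) → ℂ} {b δ : ℝ} {y' : Tor M} (hb : 0 ≤ b) (hδ : 0 ≤ δ)
    (h : FieldDecay M (fun i : Tor (fine n M) × Fin (d + 1) => blockOf n M i.1) F b δ y') :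
    FieldDecay M Prod.fst (QvOp n M *ᵥ F) ((1 + Real.exp δ) * b) δ y' := by
  intro i
  obtain ⟨y, μ⟩ := i
  dsimp only
  set Φ : (Fin (d + 1) → ℤ) → ℝ := fun z => b * Real.exp (-(δ * torusSupNorm M (z - rep M y'))) with hΦ
  have hΦ0 : ∀ z, 0 ≤ Φ z := fun z => by positivity
  have hv : ∀ (z : Fin (d + 1) → ℤ) (r : Fin (d + 1) → Fin n) (μ' : Fin (d + 1)), ‖F (bpt n M (toT M z) r, μ')‖ ≤ Φ z := by
    intro z r μ'
    have h1 := h (bpt n M (toT M z) r, μ')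
    dsimp only at h1
    rw [blockOf_bpt] at h1
    have e : torusSupNorm M (rep M (toT M z) - rep M y') = torusSupNorm M (z - rep M y') :=
      torusSupNorm_congr_toT M (by rw [← toT_sub', ← toT_sub', toT_rep, toT_rep])
    simp only [hΦ]
    rw [← e]
    exact h1
  have key := norm_QvOp_mulVec_le n M F Φ hΦ0 hv (rep M y) μ
  rw [toT_rep] at key
  refine key.trans ?_
  have hadj := exp_tsn_le_of_adj M hδ y (y + B5Prop11Plancherel.unitVec M μ) y' μ (Or.inr (Or.inl rfl))
  have e2 : torusSupNorm M (rep M y + B6BondElimination.unitVec μ - rep M y')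
      = torusSupNorm M (rep M (y + B5Prop11Plancherel.unitVec M μ) - rep M y') :=
    torusSupNorm_congr_toT M (by rw [← toT_sub', ← toT_sub', toT_add, toT_rep, toT_rep, toT_rep, toT_unitVec])
  simp only [hΦ]
  rw [e2]
  nlinarith [Real.exp_pos (-(δ * torusSupNorm M (rep M y - rep M y'))), hadj]

end Transport

/-! ## §2b The averaging defects and the staircase -/

section TwoLevel

variable (N R : ℕ) [NeZero N] [NeZero R] (M : Fin (d + 1) → ℕ) [hM : ∀ μ, NeZero (M μ)]

/-- fields read through `par` keep their decay (`blockOf_{RN} x′ = blockOf_N(par x′)`). [folklore] -/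
theorem fieldDecay_parV {F : Tor (fine N M) × Fin (d + 1) → ℂ} {b δ : ℝ} {y' : Tor M}
    (h : FieldDecay M (fun i : Tor (fine N M) × Fin (d + 1) => blockOf N M i.1) F b δ y') :
    FieldDecay M (fun i : Tor (fine (R * N) M) × Fin (d + 1) => blockOf (R * N) M i.1) (fun i => F (par N R M i.1, i.2)) b δ y' := by
  intro i
  dsimp only
  rw [← blockOf_par]
  exact h (par N R M i.1, i.2)

/-- scalar version: `z ↦ φ(par z)`-type fields. [folklore] -/
theorem fieldDecay_par {F : Tor (fine N M) × Fin (d + 1) → ℂ} {b δ : ℝ} {y' : Tor M} (κ : Fin (d + 1))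
    (h : FieldDecay M (fun i : Tor (fine N M) × Fin (d + 1) => blockOf N M i.1) F b δ y') :
    FieldDecay M (blockOf (R * N) M) (fun z => F (par N R M z, κ)) b δ y' := by
  intro z
  rw [← blockOf_par]
  exact h (par N R M z, κ)

/-- **the adjoint averaging defect `E₂` transports decay with the rate factor `ρ = (R−1)∕(RN)`** (constant `ρ(1 + e^{δ})`). [folklore] -/
theorem fieldDecay_adjDefect {g : Tor M × Fin (d + 1) → ℂ} {b δ : ℝ} {y' : Tor M} (hb : 0 ≤ b) (hδ : 0 ≤ δ)
    (h : FieldDecay M Prod.fst g b δ y') :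
    FieldDecay M (fun i : Tor (fine (R * N) M) × Fin (d + 1) => blockOf (R * N) M i.1) (adjDefect N R M *ᵥ g)
      ((((R : ℝ) - 1) / ((R : ℝ) * N)) * ((1 + Real.exp δ) * b)) δ y' := by
  intro i
  obtain ⟨x, μ⟩ := i
  dsimp only
  rw [adjDefect_mulVec_apply, norm_mul]
  have hρ := ratio_nonneg N R
  have h1 := h (blockOf (R * N) M x, μ)
  have h2 := h (blockOf (R * N) M x - B5Prop11Plancherel.unitVec M μ, μ)
  dsimp only at h1 h2
  have hadj := exp_tsn_le_of_adj M hδ (blockOf (R * N) M x) (blockOf (R * N) M x - B5Prop11Plancherel.unitVec M μ) y' μ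
    (Or.inr (Or.inr rfl))
  have hsub : ‖g (blockOf (R * N) M x, μ) - g (blockOf (R * N) M x - B5Prop11Plancherel.unitVec M μ, μ)‖
      ≤ (1 + Real.exp δ) * b * Real.exp (-(δ * torusSupNorm M (rep M (blockOf (R * N) M x) - rep M y'))) := by
    refine (norm_sub_le _ _).trans ?_
    nlinarith [mul_le_mul_of_nonneg_left hadj hb, Real.exp_pos (-(δ * torusSupNorm M (rep M (blockOf (R * N) M x) - rep M y')))]
  calc _ ≤ (((R : ℝ) - 1) / ((R : ℝ) * N)) * ((1 + Real.exp δ) * b * Real.exp (-(δ * torusSupNorm M (rep M (blockOf (R * N) M x) - rep M y')))) :=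
        mul_le_mul (norm_piF_le N R M μ x) hsub (norm_nonneg _) hρ
    _ = _ := by ring

/-- **the forward averaging defect `E₁` transports decay with the rate factor `ρ`** (constant `ρ(1 + e^{δ})∕2`; the telescoped ends lie in
`B(y)` and `B(y + e_μ)`). [folklore] -/
theorem fieldDecay_fwdDefect {u : Tor (fine N M) × Fin (d + 1) → ℂ} {b δ : ℝ} {y' : Tor M} (hb : 0 ≤ b) (hδ : 0 ≤ δ)
    (h : FieldDecay M (fun i : Tor (fine N M) × Fin (d + 1) => blockOf N M i.1) u b δ y') :
    FieldDecay M Prod.fst (fwdDefect N R M *ᵥ u) ((((R : ℝ) - 1) / ((R : ℝ) * N)) * ((1 + Real.exp δ) / 2 * b)) δ y' := by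
  intro i
  obtain ⟨y, μ⟩ := i
  dsimp only
  have hR : 0 < R := Nat.pos_of_ne_zero (NeZero.ne R)
  have hR1 : (1 : ℝ) ≤ R := by exact_mod_cast hR
  have hN : (0 : ℝ) < N := by exact_mod_cast Nat.pos_of_ne_zero (NeZero.ne N)
  have hadj := exp_tsn_le_of_adj M hδ y (y + B5Prop11Plancherel.unitVec M μ) y' μ (Or.inr (Or.inl rfl))
  rw [fwdDefect_mulVec_apply, norm_mul, norm_mul, cL_eq R hR]
  have h1 : ‖((R : ℂ) - 1) / (2 * R)‖ = ((R : ℝ) - 1) / (2 * R) := by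
    rw [show ((R : ℂ) - 1) / (2 * R) = ((((R : ℝ) - 1) / (2 * R) : ℝ) : ℂ) by push_cast; ring, Complex.norm_real,
      Real.norm_of_nonneg (div_nonneg (by linarith) (by positivity))]
  have h2 : ‖(1 / (N : ℂ) ^ (d + 1 + 1))‖ = 1 / (N : ℝ) ^ (d + 1 + 1) := by
    rw [norm_div, norm_one, norm_pow, Complex.norm_natCast]
  have hterm : ∀ j : Fin (d + 1) → Fin N,
      ‖u (bpt N M y j + tstep (fine N M) μ N, μ) - u (bpt N M y j, μ)‖
        ≤ (1 + Real.exp δ) * b * Real.exp (-(δ * torusSupNorm M (rep M y - rep M y'))) := by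
    intro j
    have ha := h (bpt N M y j + tstep (fine N M) μ N, μ)
    have hb' := h (bpt N M y j, μ)
    dsimp only at ha hb'
    have hblk : blockOf N M (bpt N M y j + tstep (fine N M) μ N) = y + B5Prop11Plancherel.unitVec M μ := by
      rw [B5Block118.bpt_add_tstep, blockOf_bpt]
    rw [hblk] at ha
    rw [blockOf_bpt] at hb'
    calc _ ≤ ‖u (bpt N M y j + tstep (fine N M) μ N, μ)‖ + ‖u (bpt N M y j, μ)‖ := norm_sub_le _ _
      _ ≤ b * (Real.exp δ * Real.exp (-(δ * torusSupNorm M (rep M y - rep M y'))))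
            + b * Real.exp (-(δ * torusSupNorm M (rep M y - rep M y'))) :=
          add_le_add (ha.trans (mul_le_mul_of_nonneg_left hadj hb)) hb'
      _ = _ := by ring
  have h3 : ‖∑ j : Fin (d + 1) → Fin N, (u (bpt N M y j + tstep (fine N M) μ N, μ) - u (bpt N M y j, μ))‖
      ≤ (N : ℝ) ^ (d + 1) * ((1 + Real.exp δ) * b * Real.exp (-(δ * torusSupNorm M (rep M y - rep M y')))) := by
    calc _ ≤ ∑ j : Fin (d + 1) → Fin N, ‖u (bpt N M y j + tstep (fine N M) μ N, μ) - u (bpt N M y j, μ)‖ := norm_sum_le _ _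
      _ ≤ ∑ _j : Fin (d + 1) → Fin N, (1 + Real.exp δ) * b * Real.exp (-(δ * torusSupNorm M (rep M y - rep M y'))) :=
          Finset.sum_le_sum fun j _ => hterm j
      _ = _ := by
          rw [Finset.sum_const, Finset.card_univ, Fintype.card_fun, Fintype.card_fin, Fintype.card_fin, nsmul_eq_mul]; push_cast; ring
  rw [h1, h2]
  calc ((R : ℝ) - 1) / (2 * R) * (1 / (N : ℝ) ^ (d + 1 + 1) * ‖∑ j : Fin (d + 1) → Fin N,
          (u (bpt N M y j + tstep (fine N M) μ N, μ) - u (bpt N M y j, μ))‖)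
      ≤ ((R : ℝ) - 1) / (2 * R) * (1 / (N : ℝ) ^ (d + 1 + 1)
          * ((N : ℝ) ^ (d + 1) * ((1 + Real.exp δ) * b * Real.exp (-(δ * torusSupNorm M (rep M y - rep M y')))))) :=
        mul_le_mul_of_nonneg_left (mul_le_mul_of_nonneg_left h3 (by positivity)) (div_nonneg (by linarith) (by positivity))
    _ = _ := by field_simp; ring

end TwoLevel



end Summit.QuantumFields.BalabanUV.Beta.GAN24.AveragedPropagatorLocality

end
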